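import Summits.Ventures.HodgeRepro.Tier4.Line2.CloseFormPartI

/-!
# Tier4/Line2/CloseFormPartII — LINE L2 close form, module 2 of 3: Part II, the weight-shifted anticyclotomic branch

The skeleton's Part II (Skeleton.lean v0.16 L238–L553) verbatim — `exists_torsionPt_aeval_ne_zero`,
`exists_torsionPt_forall_aeval_ne_zero`, `muInv_map_eq_of_residue_comm`, the structure `WeightShiftedBranch` and its
theorems `central_eq_zero_iff` / `branch_ne_zero` / `shift_ne_zero` / `exists_twist_good`, and `exists_datum_R1_R2` — with
v0.2's change: no global instance attribute on `WeightShiftedBranch.fieldKbar`; the instance is supplied by `letI` in the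
statement and proof of `central_eq_zero_iff` and in the proof of `exists_twist_good`.
(R-39, lead L8034: the close form goes through the GATE; the gate's `lint.statement-form` caps a Theorems file with
proofs at 400 lines, so the ONE close-form file of record — v0.2 = the v0.1 bytes ae651d9627e9699a544f292ac2dc99e89040019ebe76f89f4657c305158595b8 · 615
FILED S16093 with the two global instance attributes replaced by local `letI` — is split BY TOPIC into three modules whose
concatenation (imports / preamble / namespace lines aside) IS v0.2: `CloseFormPartI` (Part I), `CloseFormPartII` (Part II),
`CloseForm` (Parts III–IV: the two `Input_…` defs and `target_L2v3_of_inputs`).  Nothing mathematical changes; the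
skeleton Skeleton.lean v0.16 (149e57492cdfc1b9b085b226628060ec021bc4a90261752f8208ff5903fb9fe5 · 743) stays the line of
record, its display stays a declared sorry there.  HC_CM is NOT proved by anyone in this repository.)
-/

set_option autoImplicit false

noncomputable section

namespace Summit.Ventures.HodgeRepro.Tier4.Line2.CloseForm

open Summit.Ventures.HodgeRepro.PeriodCloser
open Summit.Ventures.HodgeRepro.Tier4.Common
open NumberField

variable {L : Type} [Field L] [NumberField L] [IsCMField L]

/-! ## Part II — the weight-shifted anticyclotomic branch (THE NOVELTY) -/

/-! **The coefficient ring `O` of the Katz measures and its torsion points** — LANDED as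
`Summits.Ventures.HodgeRepro.Tier4.Line2.BranchCoefficients` (t4-L2-p3, p661311; byte-verbatim the v0.8 block
L192–L233: the structure `BranchCoefficients` with its instance bundle, `BranchCoefficients.algebraMapField_injective`,
`BranchCoefficients.IsTorsionPt`), imported above and consumed BY NAME — never re-declared here. -/
example : Type 1 := BranchCoefficients

/-! **L2.3 (routine) — torsion points are evaluation points** — LANDED as
`Summits.Ventures.HodgeRepro.Tier4.Line2.HasEvalTorsionPt` (t4-L2-p3; statement byte-verbatim the v0.8 L238–L239:
`hasEval_torsionPt (O : BranchCoefficients) {d : ℕ} (η : Fin d → 𝓞_ℂ_[O.p]) (hη : O.IsTorsionPt η) :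
MvPowerSeries.HasEval (fun i => η i - 1)`), imported above and consumed BY NAME. -/
example (O : BranchCoefficients) {d : ℕ} (η : Fin d → 𝓞_ℂ_[O.p]) (hη : O.IsTorsionPt η) :
    MvPowerSeries.HasEval (fun i => η i - 1) := hasEval_torsionPt O η hη

/-! ### The kernel: torsion-point density for `O⟦T_1, …, T_d⟧` (Mathlib-level; no arithmetic)

A non-zero `d`-variable power series over the complete DVR `O` is non-zero at some torsion point `(ζ_i − 1)_i`.
Proof shape (three stubs, then the assembly `exists_torsionPt_aeval_ne_zero` PROVED):
* K1a `exists_subst_frobenius_ne_zero` — FROBENIUS LINES: for suitable exponents `k : Fin d → ℕ`, the one-variable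
  restriction `G := F((1+X)^{p^{k_1}} − 1, …, (1+X)^{p^{k_d}} − 1) ∈ O⟦X⟧` (the push-forward of the measure `F` along
  `ℤ_p^d → ℤ_p`, `e_i ↦ p^{k_i}`) is NON-ZERO.  Write `F = ϖ^μ F′` with `F′ ≢ 0 (mod ϖ)` (`μ = muInv F < ∞`,
  t4-lit-4's `muInv`); mod `ϖ` the substitution is `T_i ↦ X^{p^{k_i}}` (characteristic `p`!), so the reduction of `G′`
  is `Σ_m ā_m X^{Σ_i m_i p^{k_i}}`; let `m⁰` be the LEXICOGRAPHICALLY SMALLEST monomial of `supp F̄′` (lex on `ℕ^d` is a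
  well-order) and choose `k_1 > k_2 > … > k_d` with `p^{k_i} > Σ_{j > i} m⁰_j p^{k_j}` (depends on `m⁰` only): every
  other `m ∈ supp F̄′` has a first index `i` with `m_i > m⁰_i`, hence a strictly larger weight `Σ m_i p^{k_i}`, so the
  coefficient of `X^{weight(m⁰)}` in `Ḡ′` is `ā_{m⁰} ≠ 0`.  Hence `G′ ≠ 0` and `G = ϖ^μ G′ ≠ 0`.
* K1b `exists_torsion_aeval_ne_zero_one` — ONE VARIABLE: a non-zero `G ∈ O⟦X⟧` is non-zero at some `ζ − 1`, `ζ` a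
  `p`-power root of unity of `𝓞_{ℂ_p}`: the landed `PowerSeries.finite_rootsOfUnity_zeros_of_ne_zero`
  (Tier3Weierstrass) + infinitely many `p`-power roots of unity in `ℂ_p` (`PadicComplex.isAlgClosed`) + `ζ − 1`
  topologically nilpotent (Tier3RootsOfUnityEval).
* K1c `aeval_subst_frobenius` — COMPATIBILITY: `F(ζ^{p^{k_1}} − 1, …, ζ^{p^{k_d}} − 1) = G(ζ − 1)` (`MvPowerSeries.subst`
  is the `aeval` into `O⟦X⟧`; `MvPowerSeries.comp_aeval` with the continuous evaluation `O⟦X⟧ → 𝓞_{ℂ_p}` at `ζ − 1`,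
  `aeval_unique`).
Then `η_i := ζ^{p^{k_i}}` is a torsion point with `F(η − 1) = G(ζ − 1) ≠ 0`.

PRESEARCH (t4-lit-4 S12040 + this seat's `lit search --source local`, 19:1xZ): the `d`-variable statement is NOT printed
as one lemma on any held page; its MEASURE proof is printed in two ingredients — BH17 p. 1926 display (1-3)
(`G(ζ − 1) = ∫ χ_ζ dμ_G` for the finite-order character `χ_ζ`; one-variable twin Lang GTM 121 Ch. 4 §1 Thm 1.2) and
Hida, Ann. of Math. 172 (2010) p. 45 («finite-order characters span a dense subspace of the continuous functions on
Γ») — so `G(ζ − 1) = 0` at every torsion point ⇒ `μ_G = 0` ⇒ `G = 0`; Zariski-density of torsion points in the formal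
torus — prior art (t4-lit-4 S12487, row I-t4-lit-4-21): Serban, JTNB (doi 10.5802/jtnb.1030; `paper:arxiv-1607.01428`)
Thm 1.3 (p0003) / Lemma 2.13 / Thm 2.14 (p0008) read at `I = 0` (this seat's instantiation — Serban's §2.4 opens «for
`I` a non-trivial ideal», p0008; the statement he PRINTS for a single power series is Prop 2.9, p0006, the dichotomy
«φ vanishes on a torsion-translate line after a multiplicative change of variables» / «|φ(ζ − 1)|_p ≥ C_φ off a finite
set») — so «the torsion points are Zariski-dense in `Spec 𝒪_F⟦X_1, …, X_n⟧`», i.e. `exists_torsionPt_aeval_ne_zero`, is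
a reading of the printed results, not a quotation; Lemma 2.8 (p0006) is the diagonal Frobenius congruence,
the twin of K1c; `paper:arxiv-2208.02769 p.9` (Pollack–Serban, MRL) is a step inside their two-variable rigidity
proposition, not a torsion-density statement.  The Frobenius-line
proof K1a–K1c is the line's own (no held page): for a Lean proof it needs no Mahler/Amice dictionary, only the
char-`p` lex-min argument above and the landed one-variable pieces — the prover's call (L2-p1). -/

/-! K1a — the Frobenius-line restriction of a non-zero series is non-zero for suitable exponents.

LANDED as `Summits.Ventures.HodgeRepro.Tier4.Line2.K1a` (t4-L2-p1, p662052 ACCEPTED 19:44:39Z; statement byte-verbatim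
the v0.8 L274–L278; fq-name `Summit.Ventures.HodgeRepro.Tier4.Line2.exists_subst_frobenius_ne_zero`), imported above and consumed BY NAME. -/
example (O : BranchCoefficients) {d : ℕ} (F : MvPowerSeries (Fin d) O.A) (hF : F ≠ 0) :
    ∃ k : Fin d → ℕ, MvPowerSeries.subst
      (fun i : Fin d => (1 + PowerSeries.X) ^ O.p ^ k i - 1 : Fin d → PowerSeries O.A) F ≠ 0 :=
  exists_subst_frobenius_ne_zero O F hF

/-! K1b — one variable: a non-zero `G ∈ O⟦X⟧` is non-zero at some `ζ − 1`, `ζ ∈ 𝓞_{ℂ_p}` a `p`-power root of unity.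

LANDED as `Summits.Ventures.HodgeRepro.Tier4.Line2.K1b` (t4-L2-p2, p662366 ACCEPTED, commit 6e7bf55983d2; statement byte-verbatim
the v0.8 L281–L283; fq-name `Summit.Ventures.HodgeRepro.Tier4.Line2.exists_torsion_aeval_ne_zero_one`; body = the generic
`TorsionEval` p661604 at `O.algebraMap_injective`), imported above and consumed BY NAME. -/
example (O : BranchCoefficients) (G : PowerSeries O.A) (hG : G ≠ 0) :
    ∃ ζ : 𝓞_ℂ_[O.p], (∃ n : ℕ, ζ ^ O.p ^ n = 1) ∧
      ∃ hζ : PowerSeries.HasEval (ζ - 1), PowerSeries.aeval hζ G ≠ 0 :=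
  exists_torsion_aeval_ne_zero_one O G hG

/-! K1c — evaluating `F` at the Frobenius-line point `(ζ^{p^{k_i}} − 1)_i` is evaluating its one-variable
restriction at `ζ − 1`.

LANDED as `Summits.Ventures.HodgeRepro.Tier4.Line2.K1c` (t4-L2-p2, p662564 ACCEPTED; statement byte-verbatim the v0.8
L288–L293; fq-name `Summit.Ventures.HodgeRepro.Tier4.Line2.aeval_subst_frobenius`; body = the generic `TorsionEval`
p661604 at a `BranchCoefficients` datum), imported above and consumed BY NAME. -/
example (O : BranchCoefficients) {d : ℕ} (F : MvPowerSeries (Fin d) O.A) (k : Fin d → ℕ)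
    (ζ : 𝓞_ℂ_[O.p]) (hζ : PowerSeries.HasEval (ζ - 1))
    (hη : MvPowerSeries.HasEval (fun i : Fin d => ζ ^ O.p ^ k i - 1)) :
    MvPowerSeries.aeval hη F =
      PowerSeries.aeval hζ
        (MvPowerSeries.subst (fun i : Fin d => (1 + PowerSeries.X) ^ O.p ^ k i - 1 : Fin d → PowerSeries O.A) F) :=
  aeval_subst_frobenius O F k ζ hζ hη

/-- **L2.2 — KERNEL: torsion-point density in `d` variables** (PROVED from K1a–K1c).  A non-zero `d`-variable power
series over the complete DVR `O` is non-zero at some torsion point `(ζ_i − 1)_i` of `𝓞_{ℂ_p}^d`. -/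
theorem exists_torsionPt_aeval_ne_zero (O : BranchCoefficients) {d : ℕ}
    (F : MvPowerSeries (Fin d) O.A) (hF : F ≠ 0) :
    ∃ η : Fin d → 𝓞_ℂ_[O.p], ∃ hη : O.IsTorsionPt η,
      MvPowerSeries.aeval (hasEval_torsionPt O η hη) F ≠ 0 := by
  obtain ⟨k, hk⟩ := exists_subst_frobenius_ne_zero O F hF
  obtain ⟨ζ, ⟨n, hn⟩, hζ, hGζ⟩ := exists_torsion_aeval_ne_zero_one O _ hk
  have htor : O.IsTorsionPt (fun i : Fin d => ζ ^ O.p ^ k i) := fun i =>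
    ⟨n, by rw [← pow_mul, mul_comm, pow_mul, hn, one_pow]⟩
  refine ⟨fun i => ζ ^ O.p ^ k i, htor, ?_⟩
  rw [aeval_subst_frobenius O F k ζ hζ]
  exact hGζ

/-- **L2.2′ — a COMMON torsion point for four non-zero series** (PROVED from L2.2): the product of the four series
is non-zero in the DOMAIN `O⟦T_1, …, T_d⟧` (`MvPowerSeries.instNoZeroDivisors`), L2.2 gives a torsion point where
the product — hence every factor — is non-zero. -/
theorem exists_torsionPt_forall_aeval_ne_zero (O : BranchCoefficients) {d : ℕ}
    (F : Fin 4 → MvPowerSeries (Fin d) O.A) (hF : ∀ j, F j ≠ 0) :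
    ∃ η : Fin d → 𝓞_ℂ_[O.p], ∃ hη : O.IsTorsionPt η,
      ∀ j, MvPowerSeries.aeval (hasEval_torsionPt O η hη) (F j) ≠ 0 := by
  have hprod : (∏ j, F j) ≠ 0 := Finset.prod_ne_zero_iff.mpr fun j _ => hF j
  obtain ⟨η, hη, hne⟩ := exists_torsionPt_aeval_ne_zero O _ hprod
  refine ⟨η, hη, fun j h0 => hne ?_⟩
  rw [map_prod]
  exact Finset.prod_eq_zero (Finset.mem_univ j) h0

/-- **μ is invariant under automorphisms that are the identity mod `ϖ`** (the twist by a character with values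
in `1 + 𝔪`): for an `O`-algebra endomorphism `Φ` of `O⟦T⟧` with `Φ(F) ≡ F (mod ϖ)` for every `F`,
`μ(Φ F) = μ(F)` — write `F = ϖ^μ F′` with `F′ ≢ 0 (mod ϖ)`; `Φ F = ϖ^μ Φ(F′)` and `Φ(F′) ≡ F′ ≢ 0`.  PROVED (v0.7):
CONSUMED from t4-lit-4's landed `Tier4/LitMuInvariantApi.lean` (p660266, commit 756d0e2430dc):
`Lit.MuInvariant.muInv_map_eq_of_map_residue_eq` — the statement verbatim over any complete DVR. -/
theorem muInv_map_eq_of_residue_comm (O : BranchCoefficients) {d : ℕ}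
    (Φ : MvPowerSeries (Fin d) O.A →ₐ[O.A] MvPowerSeries (Fin d) O.A)
    (hΦ : ∀ F, MvPowerSeries.map (IsLocalRing.residue O.A) (Φ F) = MvPowerSeries.map (IsLocalRing.residue O.A) F)
    (F : MvPowerSeries (Fin d) O.A) : Lit.MuInvariant.muInv (Φ F) = Lit.MuInvariant.muInv F :=
  Lit.MuInvariant.muInv_map_eq_of_map_residue_eq Φ hΦ F

/-- **The weight-shifted branch datum of line L2** at a prime `𝔭` of `E′⁺` above the interpolation prime `p`
(split in `E′`; `I.Xi 𝔭` is read on this line as the finite-order characters of the FULL anticyclotomic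
`Γ⁻ ≅ ℤ_p^d`, ramified only above `p` — `torsionPt_surjective` is that reading).

WHAT IS LOAD-BEARING IN LEAN (t4-crit-2 S12076 O3, CONCURRED): the imported Hsieh Props (`Hsieh2014_ThmA (hsieh j)`,
`Hsieh2014_Prop4_9 (interp j)`) are stated over t4-lit-4's NAMED data, whose printed hypotheses are bare `Prop`
fields — so `hsieh j := {branch := 1, badPlaces := ∅, all Props := True}` and a junk `interp j` satisfy every
displayed field independently of the face.  In the LEAN STATEMENT of `line2_inputs` the face-tied content is
therefore exactly `torsionPt_surjective`, `integral_eq`, `Lvalue_eq_zero_iff`, `rootNumber_twist`, `base_sign`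
(with `rank := 0` it collapses to «every `𝔭`-twist of the base has `L(½) ≠ 0` and root number `1`»); Hsieh's
Theorem A and Proposition 4.9 are inputs of the INTENDED CONSTRUCTION of `line2_inputs` (the genuine Katz measures
and their avatars), not consequences forced by the statement — INPUTS.md lists them as strategy inputs, not as
consumed by the Lean statement.  Fields:
* `base` — the sign-fixed admissible base datum (L2.1), with its four self-dual characters `λ_j = χ′_j |·|^{−1/2}`
  of infinity type `Σ + κ_j(1 − c)`, root numbers `+1`;
* `torsionPt ν = (ν(γ_i))_i` — a finite-order character of `Γ⁻` read at a `ℤ_p`-basis `γ_1, …, γ_d` (a torsion point);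
  every torsion point is some `ν` (`torsionPt_surjective`);
* `hsieh j` — t4-lit-4's datum of Hsieh's Theorem A for the BRANCH character `χ_br,j` of infinity type `Σ`, defined
  by `λ_j = χ_br,j · ν_{κ_j} · ω^{−κ_j}` — `ν_{κ_j}` an algebraic Hecke character of infinity type `κ_j(1 − c)`
  UNRAMIFIED at `p` (conductor a prime-to-`p` `𝔣` killing the roots of unity; it exists since `(1 − c)` kills the
  units of `E′`), `ω^{−κ_j}` the Teichmüller twist at the places of `Σ_p` — so that `λ̂_j = χ̂_br,j · ψ_j` with
  `ψ_j = ⟨·⟩^{κ_j} : Γ⁻ → 1 + 𝔪` THE WEIGHT SHIFT (the wild part of `y ↦ y^{κ_j}`).  This is EXACTLY Hsieh's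
  `χ ↦ χ_κ` of Prop (P:2.V) (Main_Body.tex L476–L495, t4-lit-4 S11962 (2)) read backwards: `χ_br,j` is the type-`Σ`
  character of which `λ_j` is the `κ_j`-th moment character (`χ̂_κ = χ̂ ν_κ`, `ν_κ(rec_{Σ_p}(y)) = y^κ` on `Γ′ ≅ 1 + pO`);
  the `p`-part of the conductor of `χ_br,j` is TAME — allowed as printed (Hsieh fixes only the prime-to-`p` conductor,
  L54 / L58 / L61–L62 / §4.1 L170; `φ_μ`, `φ^{[u]}_w` take `λ_w` on `O_{F_v}^×` ramified included — S11962 (1));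
* `branch j = G_j` — the Katz branch element `L⁻_{Σ, χ_br,j} ∈ O[[Γ⁻]] ≅ O[[T_1, …, T_d]]` of `χ_br,j` (Katz 1978 Thm
  (5.3.0); HT93 Thm II; Hsieh §4), the same object as `(hsieh j).branch` (`hsieh_link`: equal μ suffices);
* `twist j` — the `ψ_j`-TWIST `[γ] ↦ ψ_j(γ)[γ]` of the Iwasawa algebra, an `O`-algebra automorphism of `O⟦T⟧`
  (`T_i ↦ ψ_j(γ_i)(1 + T_i) − 1`), which is the IDENTITY mod `ϖ` because `ψ_j ≡ 1 (mod 𝔪)` (`twist_residue`);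
  `twist j (branch j) = L⁻_{Σ, λ_j}` is the anticyclotomic Katz measure of the LINE character `λ_j` itself
  (`L⁻_{χψ,Σ}(ν) = L_{𝔠,Σ}(χ̂ ψ ν) = L⁻_{χ,Σ}(ψ ν)`: the pull-back definition, HT93 / Hsieh (4.x));
* `hsieh_hyps j`, `hsieh_thmA j`, `hsieh_ramified j` — DISPLAYED INPUT: Hsieh 2014 Thm A for the type-`Σ` branch
  character `χ_br,j` (the imported Prop `Hsieh2014_ThmA`), its printed hypotheses asserted for `χ_br,j` — `p > 2`,
  (ord), `p ∤ D_{E′⁺}`, `𝔠_j` = the prime-to-`p` conductor of `χ_br,j` (= cond(λ_j)·𝔣), and (R) `W(χ_br,j*) = 1`, which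
  is a HYPOTHESIS of Thm A itself (L73–L78, S11962 (3)) and is TRANSPORTED from `base_sign j` by the sign bookkeeping
  of the twist `λ_j = χ_br,j ν_{κ_j} ω^{−κ_j}`: the archimedean root numbers change by `(−1)^{|κ_j|}` (the unitary
  type at `σ ∈ Σ` goes from `(z/|z|)^{1}` to `(z/|z|)^{1+2κ_σ}`, `ε_σ = i^{1+2κ_σ}`), the `p`-adic ones by
  `Π_{w ∈ Σ_p} (ν_{κ_j} ω^{−κ_j})_w(−1) = Π_w ω(−1)^{κ_w} = (−1)^{|κ_j|}` (Tate's pair identity at the split places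
  `ε(½, μ_w) ε(½, μ_w̄) = μ_w(−1)`; `ν_{κ_j}` unramified at `p`), all other places unchanged — product `1`, the same
  constancy that makes Hsieh's `χ_κ` have `W(χ_κ*) = W(χ*)`; this bookkeeping is the line's step (c) — a CELL
  computation from three printed facts (t4-lit-4 S12065, row 14): Kudla, «Tate's thesis» Prop 3.8 (iv) (ε at ℂ:
  `ε(s, x^{−a} x̄^{−b}, ψ) = i^{max(a,b)}`, p0109:L17–L19), Hsieh 2012 AJM Lemma 6.6 (2) (split `v`: `W(χ*_v) = χ*_v(2ϑ)`,
  pdf022:L61–L70) and the product formula `W = Π_v W_v` (Kudla (4.6) p0112:L5–L8); the two `(−1)`-factors cancel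
  because each `κ_{j,σ} ∈ {0, 2}` is EVEN (R2-PINNING.md L112) — the composite «`W((χν)*) = W(χ*)`» itself is on no
  held page (Rohrlich 1982 not held) — and the ramification of `χ_br,j` at `v | 𝔠_j⁻`; together with `hsieh_link`, `twist_residue` and
  `muInv_map_eq_of_residue_comm` they PROVE `shift_ne_zero`: `μ(L⁻_{Σ,λ_j}) = μ(L⁻_{Σ,χ_br,j}) = Σ_{v | 𝔠_j⁻}
  μ_p(χ_br,j,v) < ∞` — for ALL FOUR lines, `κ_j ≠ 0` included;
* `interp j`, `interp_hyps`, `interp_prop`, `interpChar`, `integral_eq`, `Lvalue_eq_zero_iff`, `eulP_ne_zero`,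
  `eulC_ne_zero`, `arch_ne_zero`, `unitIndex_ne_zero` — THE INTERPOLATION BLOCK: Hsieh 2014 Prop 4.9 CONSUMED AS TYPED
  by t4-lit-4 (`Tier4/LitInterpolation.lean`, p659169: `InterpolationData`, the imported Prop `Hsieh2014_Prop4_9` and
  its proved corollary `integral_eq_zero_iff_Lvalue_eq_zero`), with the line's three identifications as fields:
  `interpChar j ν` = the avatar `λ̂_j ν = χ̂_br,j ψ_j ν` (in the §4.1 range: type `Σ + κ_j(1 − c)`); `integral_eq` =
  the `κ_j`-th moment reading of `∫ λ̂_j ν dℒ_{𝔠,Σ}` as the value of `twist j (branch j)` at the torsion point `ν`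
  (DEFINITIONAL, Hsieh L62–L63 + Prop (P:2.V), t4-lit-4 S11962 (2) / S12003); `Lvalue_eq_zero_iff` = `L^{(p𝔠)}(0, λ_j ν)`
  vanishes iff `L(½, χ′_j ν)` does (finitely many non-zero removed Euler factors; the unitary shift `s = 0 ↦ ½`); and
  the non-vanishing of the named complex factors (`Eul_p`: Gauss-sum units at `w ∈ Σ_p`, Lemma E / Tier3GaussSumPair;
  `Eul_{𝔠⁺}`, `arch`, the unit index: by their printed forms).  From these, `central_eq_zero_iff` is PROVED (L2.4d):
  `L(½, χ′_j ν) = 0 ⟺ L⁻_{Σ,λ_j}(ν − 1) = 0`;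
* `rootNumber_twist` — DISPLAYED INPUT: the root number is CONSTANT (= `+1`) along all finite-order anticyclotomic
  twists ramified only above `p` — each place above `p` splits, and at a split place `ε(λ_w ν_w) ε(λ_{w̄} ν_{w̄}) =
  (λ_w ν_w)(−1) = λ_w(−1)` (Tate; `ν_w(−1) = 1`, `p` odd); no exceptional twists. -/
structure WeightShiftedBranch (I : C7Face L) (𝔭 : I.Place) (O : BranchCoefficients) where
  /-- the sign-fixed admissible base datum -/
  base : I.Datum
  base_admissible : I.Admissible base
  base_sign : ∀ j : Fin 4, I.rootNumber (I.chars base j) = 1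
  /-- `d = [E′⁺ : ℚ]`, the `ℤ_p`-rank of `Γ⁻` -/
  rank : ℕ
  /-- `ν ↦ (ν(γ_i))_i` -/
  torsionPt : I.Xi 𝔭 → Fin rank → 𝓞_ℂ_[O.p]
  torsionPt_isTorsion : ∀ ν, O.IsTorsionPt (torsionPt ν)
  /-- every torsion point of `𝓞_{ℂ_p}^d` is a finite-order character of `Γ⁻` -/
  torsionPt_surjective : ∀ η : Fin rank → 𝓞_ℂ_[O.p], O.IsTorsionPt η → ∃ ν, torsionPt ν = η
  /-- the four branch elements `G_j = L⁻_{Σ,χ_br,j}` of the weight-shifted branch characters -/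
  branch : Fin 4 → MvPowerSeries (Fin rank) O.A
  /-- the datum of Hsieh's Theorem A for the branch character `χ_br,j` (t4-lit-4's `HsiehData`: its variables,
  its measure `ℒ⁻_{χ_br,j,Σ}`, the places `v | 𝔠_j⁻`, the local components, the eight printed hypotheses) -/
  hsieh : Fin 4 → Lit.MuInvariant.HsiehData O.A
  /-- `G_j` IS Hsieh's measure for `χ_br,j` (the same object under `O[[Γ⁻]] ≅ O[[T_1, …, T_d]]`; equal μ-invariants
  suffice — the same link as t4-lit-4's chain-A corollary) -/
  hsieh_link : ∀ j, Lit.MuInvariant.muInv (branch j) = Lit.MuInvariant.muInv (hsieh j).branch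
  /-- the printed hypotheses of Theorem A HOLD for `χ_br,j` (see the structure docstring) -/
  hsieh_hyps : ∀ j, (hsieh j).Hypotheses
  /-- DISPLAYED INPUT — **Hsieh 2014, Theorem A** for `χ_br,j`, as typed by t4-lit-4
  (`Tier4/LitMuInvariant.lean`, row I-t4-lit-4-1) -/
  hsieh_thmA : ∀ j, Lit.MuInvariant.Hsieh2014_ThmA (hsieh j)
  /-- `χ_br,j,v ≢ 1` at every `v | 𝔠_j⁻` (`v` divides the conductor, so `χ_br,j,v` is ramified) -/
  hsieh_ramified : ∀ j, ∀ v ∈ (hsieh j).badPlaces, ∃ x : (hsieh j).Kv v, (hsieh j).chiLocal v x ≠ 1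
  /-- THE WEIGHT SHIFT: the `ψ_j`-twist automorphism of the Iwasawa algebra, `T_i ↦ ψ_j(γ_i)(1 + T_i) − 1` -/
  twist : Fin 4 → (MvPowerSeries (Fin rank) O.A →ₐ[O.A] MvPowerSeries (Fin rank) O.A)
  /-- `ψ_j ≡ 1 (mod 𝔪)`: the twist is the identity mod `ϖ` -/
  twist_residue : ∀ j F, MvPowerSeries.map (IsLocalRing.residue O.A) (twist j F) =
    MvPowerSeries.map (IsLocalRing.residue O.A) F
  /-- the field of algebraic numbers `ℚ̄` of Hsieh's Prop 4.9 (its values are read through `ι_p`, `ι_∞`) -/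
  Kbar : Type
  [fieldKbar : Field Kbar]
  /-- t4-lit-4's datum of **Hsieh 2014, Prop 4.9** for line `j` (`Tier4/LitInterpolation.lean`, rows 2 / 10): the
  avatars of the §4.1 range, `∫ χ̂ dℒ_{𝔠,Σ} ∈ O`, the periods, and the complex factors `L^{(p𝔠)}(0, χ)`, `Eul_p`,
  `Eul_{𝔠⁺}`, `arch`, `[𝒪_K^× : 𝒪_F^×]`, `t_K` as named data -/
  interp : Fin 4 → Lit.Interpolation.InterpolationData O.A ℂ_[O.p] Kbar
  /-- its printed standing hypotheses hold (`p > 2`, (ord), the `p`-ordinary type, the choice of `ϑ`) -/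
  interp_hyps : ∀ j, (interp j).Hypotheses
  /-- DISPLAYED INPUT — **Hsieh 2014, Proposition 4.9** as typed by t4-lit-4 (the imported Prop, p659169) -/
  interp_prop : ∀ j, Lit.Interpolation.Hsieh2014_Prop4_9 (interp j)
  /-- the avatar `λ̂_j ν = χ̂_br,j ψ_j ν` of the `ν`-twist of line `j` — an element of the §4.1 range (infinity type
  `Σ + κ_j(1 − c)`, `k = 1`, `κ_j ≥ 0`; `𝔠_j` divisible by its prime-to-`p` conductor) -/
  interpChar : ∀ j : Fin 4, I.Xi 𝔭 → (interp j).Char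
  /-- DEFINITIONAL (Hsieh L62–L63 + Prop (P:2.V), t4-lit-4 S12003 «the relation between `integral` at `ν_κ ν` and the
  `κ`-moment is the definition of the measure's value at a character»): `∫ λ̂_j ν dℒ_{𝔠,Σ}` IS the value of
  `L⁻_{Σ,λ_j} = twist j (branch j)` at the torsion point `ν` -/
  integral_eq : ∀ (j : Fin 4) (ν : I.Xi 𝔭), algebraMap O.A 𝓞_ℂ_[O.p] ((interp j).integral (interpChar j ν)) =
    MvPowerSeries.aeval (hasEval_torsionPt O (torsionPt ν) (torsionPt_isTorsion ν)) (twist j (branch j))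
  /-- `L^{(p𝔠_j)}(0, λ_j ν) = 0 ⟺ L(½, χ′_j ν) = 0`: the removed Euler factors at `p𝔠_j` are finitely many non-zero
  numbers, `λ_j ν = χ′_j ν |·|^{−1/2}` shifts `s = 0` to `s = ½` (the unitary normalisation of `centralValue`) -/
  Lvalue_eq_zero_iff : ∀ (j : Fin 4) (ν : I.Xi 𝔭),
    (interp j).Lvalue (interpChar j ν) = 0 ↔ I.centralValue (I.twist 𝔭 (I.chars base j) ν) = 0
  /-- `Eul_p(λ_j ν) ≠ 0`: at `w ∈ Σ_p` the factor is a Gauss-sum unit for `(λ_j ν)_w` ramified (Lemma E;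
  Tier3GaussSumPair `gaussSum_ne_zero_of_isPrimitive`) and `L(0, χ_w)/(ε L(1, χ_w^{−1}))` for unramified `χ_w` -/
  eulP_ne_zero : ∀ (j : Fin 4) (ν : I.Xi 𝔭), (interp j).eulP (interpChar j ν) ≠ 0
  /-- `Eul_{𝔠⁺}(λ_j ν) ≠ 0` (local `L`- and `ε`-factors at `w | 𝔉`, each non-zero) -/
  eulC_ne_zero : ∀ (j : Fin 4) (ν : I.Xi 𝔭), (interp j).eulC (interpChar j ν) ≠ 0
  /-- `π^κ Γ_Σ(kΣ + κ) / (√|D_F| (Im ϑ)^κ Ω_∞^{kΣ+2κ}) ≠ 0` by its printed form -/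
  arch_ne_zero : ∀ (j : Fin 4) (ν : I.Xi 𝔭), (interp j).arch (interpChar j ν) ≠ 0
  /-- `[𝒪_K^× : 𝒪_F^×] ≠ 0` -/
  unitIndex_ne_zero : ∀ j : Fin 4, (interp j).unitIndex ≠ 0
  /-- DISPLAYED INPUT (Tate, split places): the root numbers stay `+1` along every twist -/
  rootNumber_twist : ∀ (j : Fin 4) (ν : I.Xi 𝔭), I.rootNumber (I.twist 𝔭 (I.chars base j) ν) = 1

-- (v0.2) no global instance attribute: `fieldKbar` is supplied by `letI` where needed

namespace WeightShiftedBranch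

variable {I : C7Face L} {𝔭 : I.Place} {O : BranchCoefficients} (S : WeightShiftedBranch I 𝔭 O)

/-- **L2.4d — the vanishing transfer** (PROVED from the IMPORTED `Hsieh2014_Prop4_9.integral_eq_zero_iff_Lvalue_eq_zero`,
t4-lit-4): the central value of the `ν`-twist of line `j` vanishes iff `L⁻_{Σ,λ_j} = twist j (branch j)` vanishes at
the torsion point `ν`. -/
theorem central_eq_zero_iff (j : Fin 4) (ν : I.Xi 𝔭) :
    letI := S.fieldKbar
    I.centralValue (I.twist 𝔭 (I.chars S.base j) ν) = 0 ↔
      MvPowerSeries.aeval (hasEval_torsionPt O (S.torsionPt ν) (S.torsionPt_isTorsion ν)) (S.twist j (S.branch j)) = 0 := by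
  letI := S.fieldKbar
  have h := (S.interp_prop j).integral_eq_zero_iff_Lvalue_eq_zero (S.interp_hyps j) O.algebraMapField_injective
    (S.interpChar j ν) (S.eulP_ne_zero j ν) (S.eulC_ne_zero j ν) (S.arch_ne_zero j ν) (S.unitIndex_ne_zero j)
  rw [← S.Lvalue_eq_zero_iff j ν, ← S.integral_eq j ν, ← h]
  exact (map_eq_zero_iff (algebraMap O.A 𝓞_ℂ_[O.p]) O.algebraMap_injective).symm

/-- **L2.4a — the four branch elements are non-zero** (PROVED from the IMPORTED `Hsieh2014_ThmA.branch_ne_zero`,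
t4-lit-4): `μ(G_j) = μ(ℒ⁻_{χ_br,j,Σ}) = Σ_{v | 𝔠_j⁻} μ_p(χ_br,j,v) < ∞`. -/
theorem branch_ne_zero (j : Fin 4) : S.branch j ≠ 0 := by
  rw [← Lit.MuInvariant.muInv_ne_top_iff, S.hsieh_link j, Lit.MuInvariant.muInv_ne_top_iff]
  exact (S.hsieh_thmA j).branch_ne_zero (S.hsieh_hyps j) (S.hsieh_ramified j)

/-- **L2.4b — the four WEIGHT-SHIFTED measures `L⁻_{Σ,λ_j} = twist j (branch j)` are non-zero** (PROVED: μ is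
twist-invariant, `muInv_map_eq_of_residue_comm`, + L2.4a) — for all four lines, `κ_j ≠ 0` included: this is where
chain B's He 2025 / BHTY input is replaced by Hsieh's theorem on the branch character. -/
theorem shift_ne_zero (j : Fin 4) : S.twist j (S.branch j) ≠ 0 := by
  rw [← Lit.MuInvariant.muInv_ne_top_iff, muInv_map_eq_of_residue_comm O (S.twist j) (S.twist_residue j),
    Lit.MuInvariant.muInv_ne_top_iff]
  exact S.branch_ne_zero j

/-- **L2.5 — ONE common twist makes all four lines good** (PROVED from L2.2′ and L2.4b): the common torsion point
of the four weight-shifted measures is a finite-order character `ν` of `Γ⁻` with `ε(½, χ′_j ν) = +1` and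
`L(½, χ′_j ν) ≠ 0` for every `j`. -/
theorem exists_twist_good :
    ∃ ν : I.Xi 𝔭, ∀ j : Fin 4, I.rootNumber (I.twist 𝔭 (I.chars S.base j) ν) = 1 ∧
      I.centralValue (I.twist 𝔭 (I.chars S.base j) ν) ≠ 0 := by
  letI := S.fieldKbar
  obtain ⟨η, hη, hne⟩ :=
    exists_torsionPt_forall_aeval_ne_zero O (fun j => S.twist j (S.branch j)) S.shift_ne_zero
  obtain ⟨ν, hν⟩ := S.torsionPt_surjective η hη
  refine ⟨ν, fun j => ⟨S.rootNumber_twist j ν, fun h0 => hne j ?_⟩⟩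
  have h := (S.central_eq_zero_iff j ν).mp h0
  subst hν
  exact h

end WeightShiftedBranch

/-- **L2.6 — the twisted datum is admissible with (R1) ∧ (R2)** (PROVED): twist the base datum by the common `ν`
(`AdmissibleFamily.twist_mem`, `𝔭` split); its characters are `χ′_j ν`. -/
theorem exists_datum_R1_R2 (I : C7Face L) (h : EndoscopicInputs I) (𝔭 : I.Place) (h𝔭 : I.IsSplit 𝔭)
    (O : BranchCoefficients) (S : WeightShiftedBranch I 𝔭 O) :
    ∃ d : I.Datum, I.Admissible d ∧ I.R1 d ∧ I.R2 d := by
  obtain ⟨ν, hν⟩ := S.exists_twist_good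
  obtain ⟨d, hd, hchars⟩ := h.family.twist_mem S.base 𝔭 ν S.base_admissible h𝔭
  refine ⟨d, hd, fun j => ?_, fun j => ?_⟩
  · rw [hchars]
    exact (hν j).1
  · show I.centralValue (I.chars d j) ≠ 0
    rw [hchars]
    exact (hν j).2

end Summit.Ventures.HodgeRepro.Tier4.Line2.CloseForm
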